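import Summits.ResolutionOfSingularities.ResolutionOfSingularities.Theorems.FrobeniusClosingSteerCore4DictionaryLeaf
import Summits.ResolutionOfSingularities.ResolutionOfSingularities.Theorems.FrobeniusClosingSteerCore4IsoChartZero
import Summits.ResolutionOfSingularities.ResolutionOfSingularities.Theorems.FrobeniusClosingSteerCore4IsoIsol
import Summits.ResolutionOfSingularities.ResolutionOfSingularities.Theorems.FrobeniusClosingSteerCore4IsoOrderBound
import Mathlib.RingTheory.Ideal.Cotangent
import HarnessLib

/-!
# Crux `Steer` (stmt-ResolutionOfSingularities-16345), line `switching_dichotomy` r10, stub `stub_core4Dictionary`: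
# the leaf's dictionary hypotheses T1 / I / S DISCHARGED from the tree — `stub_core4Dictionary` modulo T2 only

OURS (campaign res-hironaka, rung L, slot W4.1, chain W4.1; replaces the role of no printed item; NOT a statement
of the manuscript under review; AI-written, weaker than expert review). The leaf
`Core4Dictionary.stub_core4Dictionary_of_dict` (`…DictionaryLeaf.lean`, p480959) proves the registered
`Sig.stub_core4Dictionary` from four Theses-free dictionary statements T1/T2/I/S. Three of them are in the tree:
* T1 (`dictT1_holds`) from res-L0-w41-stub-4's `ChartZero.chart_zero` (p478399) — which moreover sends a
  prescribed `x ∈ 𝔪 ∖ 𝔪²` to a prescribed variable; we supply such an `x` when `d > 0` (the cotangent space of a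
  non-field Noetherian local ring is non-trivial) and the constant chart `C ∘ ι ∘ residue` when `d = 0`;
* I (`dictI_holds`) = res-L0-w41-stub-2's `Isol.isol_transfer` (p479356), binder for binder;
* S (`dictS_holds`) = `order_le_of_X_pow_dvd_subst` (`…Core4IsoOrderBound.lean`), binder for binder.
Hence `stub_core4Dictionary_of_chartStep`: the registered stub follows from T2 `chart_step` ALONE (res-L0-w41-stub-1,
`…ChartStepLift/Point` landed, FC2-at-the-next-centre in progress). [folklore]
-/

noncomputable section

-- single-problem summit: the doubled namespace component `ResolutionOfSingularities` is forced by the tree layout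
set_option linter.dupNamespace false

open Classical
open Literature.AlgebraicGeometry.Resolution
open MvPowerSeries IsLocalRing
open Summit.ResolutionOfSingularities.ResolutionOfSingularities.Theorems.WildCones

namespace Summit.ResolutionOfSingularities.ResolutionOfSingularities.Theorems.SwitchingDichotomy.Core4Dictionary

/-- A regular local ring with positive embedding dimension has an element of `𝔪 ∖ 𝔪²`. [folklore] -/
theorem exists_mem_not_mem_sq {R : Type} [CommRing R] [IsRegularLocalRing R] {d : ℕ}
    (hd : (maximalIdeal R).spanFinrank = d) (hd0 : 0 < d) :
    ∃ x : R, x ∈ maximalIdeal R ∧ x ∉ maximalIdeal R ^ 2 := by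
  by_contra h
  push Not at h
  have hsub : Subsingleton (CotangentSpace R) := by
    refine ⟨fun a b => ?_⟩
    obtain ⟨a', rfl⟩ := (maximalIdeal R).toCotangent_surjective a
    obtain ⟨b', rfl⟩ := (maximalIdeal R).toCotangent_surjective b
    rw [((maximalIdeal R).toCotangent_eq_zero a').mpr (h a' a'.2),
      ((maximalIdeal R).toCotangent_eq_zero b').mpr (h b' b'.2)]
  have hF : IsField R := subsingleton_cotangentSpace_iff.mp hsub
  have hbot : maximalIdeal R = ⊥ := (IsLocalRing.isField_iff_maximalIdeal_eq).mp hF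
  rw [hbot, Submodule.spanFinrank_bot] at hd
  omega

/-- **T1 of the leaf, from the tree** (`ChartZero.chart_zero`, p478399; the case `d = 0` by the constant chart).
[folklore] -/
theorem dictT1_holds : (∀ {K : Type} [Field K] (O : ValuationSubring K) {κ : Type} [Field κ] (ι : ResidueField O →+* κ)
      (p : ℕ) [Fact p.Prime] [CharP K p] (R : Subring K) (hR : R ≤ O.toSubring)
      [IsRegularLocalRing R], SubringDominates R O.toSubring → ∀ (d : ℕ),
      (maximalIdeal R).spanFinrank = d →
      ∃ φ : R →+* MvPowerSeries (Fin d) κ,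
        (∀ r : R, constantCoeff (φ r) = ι (residue O (Subring.inclusion hR r))) ∧
        Ideal.map φ (Ideal.comap (Subring.inclusion hR) (maximalIdeal O)) =
          Ideal.span (Set.range (X : Fin d → MvPowerSeries (Fin d) κ))) := by
  intro K _ O κ _ ι p _ _ R hR _ hdom d hd
  by_cases hd0 : d = 0
  · subst hd0
    -- the constant chart `r ↦ C (ι (res r))`
    let φ : R →+* MvPowerSeries (Fin 0) κ :=
      (MvPowerSeries.C : κ →+* MvPowerSeries (Fin 0) κ).comp
        (ι.comp ((residue O).comp (Subring.inclusion hR)))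
    refine ⟨φ, fun r => by simp [φ], ?_⟩
    have hbot : maximalIdeal R = ⊥ :=
      (Submodule.spanFinrank_eq_zero_iff_eq_bot (IsNoetherian.noetherian _)).mp hd
    have hcen : Ideal.comap (Subring.inclusion hR) (maximalIdeal O) = ⊥ := by
      rw [ChartZero.comap_maximalIdeal_eq_of_subringDominates O R hR hdom, hbot]
    rw [hcen, Ideal.map_bot]
    symm
    rw [Ideal.span_eq_bot]
    rintro _ ⟨s, rfl⟩
    exact (Fin.elim0 s : False).elim
  · obtain ⟨x, hx, hx2⟩ := exists_mem_not_mem_sq hd (Nat.pos_of_ne_zero hd0)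
    obtain ⟨φ, h1, h2, -⟩ := ChartZero.chart_zero O ι p R hR hdom d hd x hx hx2 ⟨0, Nat.pos_of_ne_zero hd0⟩
    exact ⟨φ, h1, h2⟩

/-- **I of the leaf, from the tree** (`Isol.isol_transfer`, res-L0-w41-stub-2, p479356). [folklore] -/
theorem dictI_holds : (∀ {K : Type} [Field K] (O : ValuationSubring K) {κ : Type} [Field κ]
      (p : ℕ) [Fact p.Prime] [CharP K p] [CharP κ p] [PerfectField κ]
      (R : Subring K) (hR : R ≤ O.toSubring) [IsRegularLocalRing R], SubringDominates R O.toSubring →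
      PerfectField (ResidueField R) →
      ∀ (d : ℕ), (maximalIdeal R).spanFinrank = d → ∀ (φ : R →+* MvPowerSeries (Fin d) κ),
      Ideal.map φ (Ideal.comap (Subring.inclusion hR) (maximalIdeal O)) =
        Ideal.span (Set.range (X : Fin d → MvPowerSeries (Fin d) κ)) → ∀ (f : R) (N : ℕ),
      Ideal.comap (Subring.inclusion hR) (maximalIdeal O) ^ N ≤
        Ideal.span (Set.range fun δ : Derivation ℤ R R => δ f) →
      Ideal.span (Set.range (X : Fin d → MvPowerSeries (Fin d) κ)) ^ N ≤
        Ideal.span (Set.range fun l : Fin d => MvPowerSeries.pderiv l (φ f))) := by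
  intro K _ O κ _ p _ _ _ _ R hR _ hdom hperf d hd φ h2 f N hN
  haveI := hperf
  exact Isol.isol_transfer O p R hR hdom d hd φ h2 f N hN

/-- **S of the leaf, from the tree** (`order_le_of_X_pow_dvd_subst`, `…Core4IsoOrderBound.lean`). [folklore] -/
theorem dictS_holds : (∀ {κ : Type} [Field κ] {d : ℕ} (j : Fin d) (τ : Fin d → κ) (H : MvPowerSeries (Fin d) κ) (e : ℕ),
      X j ^ e ∣ subst (fun s : Fin d => if s = j then (X j : MvPowerSeries (Fin d) κ) else X j * (X s + C (τ s))) H →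
      (e : ℕ∞) ≤ H.order) :=
  fun j τ H e h => SwitchingDichotomy.order_le_of_X_pow_dvd_subst j τ H e h

/-- **`Sig.stub_core4Dictionary` from T2 `chart_step` alone** (T1, I, S discharged from the tree; the leaf
`stub_core4Dictionary_of_dict`, p480959). [folklore] -/
theorem stub_core4Dictionary_of_chartStep
    (hT2 : (∀ {K : Type} [Field K] (O : ValuationSubring K) {κ : Type} [Field κ] (ι : ResidueField O →+* κ)
      (k₀ : Subfield κ) [PerfectField k₀], Algebra.IsAlgebraic k₀ κ →
      ∀ (R R₁ : Subring K) (hR : R ≤ O.toSubring) (hR₁ : R₁ ≤ O.toSubring)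
      [IsRegularLocalRing R], SubringDominates R O.toSubring → (hQ : IsQuadraticTransformAlong O R R₁) →
      (∀ a ∈ k₀, ∃ r : R, ι (residue O (Subring.inclusion hR r)) = a) →
      ∀ (d : ℕ), (maximalIdeal R).spanFinrank = d → ∀ (φ : R →+* MvPowerSeries (Fin d) κ),
      (∀ r : R, constantCoeff (φ r) = ι (residue O (Subring.inclusion hR r))) →
      Ideal.map φ (Ideal.comap (Subring.inclusion hR) (maximalIdeal O)) =
        Ideal.span (Set.range (X : Fin d → MvPowerSeries (Fin d) κ)) →
      ∀ (x : K), x ≠ 0 → ∀ (hxR : x ∈ R), O.valuation x < 1 →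
      (∀ y ∈ R, O.valuation y < 1 → y / x ∈ R₁) →
      ∃ (j : Fin d) (τ : Fin d → κ) (φ₁ : R₁ →+* MvPowerSeries (Fin d) κ),
        (∀ r : R₁, constantCoeff (φ₁ r) = ι (residue O (Subring.inclusion hR₁ r))) ∧
        Ideal.map φ₁ (Ideal.comap (Subring.inclusion hR₁) (maximalIdeal O)) =
          Ideal.span (Set.range (X : Fin d → MvPowerSeries (Fin d) κ)) ∧
        (∀ r : R, φ₁ (Subring.inclusion hQ.le r) =
          subst (fun s : Fin d => if s = j then (X j : MvPowerSeries (Fin d) κ) else X j * (X s + C (τ s)))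
            (φ r)) ∧
        (∃ w : MvPowerSeries (Fin d) κ, IsUnit w ∧ φ₁ ⟨x, hQ.le hxR⟩ = X j * w) ∧
        (Ideal.comap (Subring.inclusion hR₁) (maximalIdeal O)).spanFinrank = d)) :
    Theses.FrobeniusClosing.IsolatedForcedTermination → ∀ p : ℕ, p.Prime →
    ∀ (k K : Type) [Field k] [CharP k p] [PerfectField k] [Field K] [Algebra k K]
    (O : ValuationSubring K) (A₀ : Subalgebra k K) (h₀ : A₀.toSubring ≤ O.toSubring) (t : K),
    A₀.FG → t ^ p ∈ A₀ → IsFractionRing (Algebra.adjoin k (insert t (A₀ : Set K))) K →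
    IsRegularLocalRing (Localization.AtPrime
      (Ideal.comap (Subring.inclusion h₀) (IsLocalRing.maximalIdeal O))) →
    (∀ x ∈ O, ∃ f : Polynomial k, f ≠ 0 ∧ Polynomial.aeval x f ∈ O.nonunits) →
    ∀ R : ℕ → Subring K, R 0 = locAtCentre A₀.toSubring O →
      (∀ i, IsQuadraticTransformAlong O (R i) (R (i + 1))) →
      ∀ s : ℕ → K, (s 0 = t ∧ (∀ i, s i ^ p ∈ R i) ∧
          ∀ i, ∃ x g : K, (x ∈ R i ∧ x ≠ 0 ∧ O.valuation x < 1 ∧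
            ∀ y ∈ R i, O.valuation y < 1 → O.valuation y ≤ O.valuation x) ∧
            g ∈ R i ∧ s i = x * s (i + 1) + g) →
      ∀ i₀ : ℕ, ∃ i, i₀ ≤ i ∧ ¬ (∃ (hf : s i ^ p ∈ R i) (N : ℕ), ∀ y : R i,
          O.valuation (y : K) < 1 →
          y ^ N ∈ Ideal.span (Set.range fun δ : Derivation ℤ (R i) (R i) => δ ⟨s i ^ p, hf⟩)) :=
  stub_core4Dictionary_of_dict dictT1_holds hT2 dictI_holds dictS_holds

end Summit.ResolutionOfSingularities.ResolutionOfSingularities.Theorems.SwitchingDichotomy.Core4Dictionary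

end
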